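import Summits.CriticalPhenomena.PercolationContinuityZ3.Theorems.PercNearOneGluingNoHeavyPcintMemAutomatonCensus
import HarnessLib

/-!
# CriticalPhenomena/PercolationContinuityZ3 — Theorems/PercNearOneGluingNoHeavyPcintMemAutomatonCensusSum.lean: the reachable state set of the memory automaton, summed over lengths

Lane prim-pcint, STRUCTURE rule, law C3 in EXACT form (gen13/README §3bis).  `…PcintMemAutomatonCensus` proved, length by length, that
the states of the memory-`τ` dangerous-set automaton that keep all `m` ages are in bijection with the 'near' self-avoiding words of
length `m` (`m + ‖ω(m)‖₁ ≤ τ`).  This file assembles the lengths: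

* `danger_comp_cast`, `isMem_comp_cast` — re-indexing a word along `Fin n' ≃ Fin n` changes nothing;
* `danger_eq_danger_suffix_of_age_le` — if no site of age `> m` is dangerous, the dangerous set is that of the last `m` letters;
* `image_danger_subset_census` — **every state reached by a memory-`τ` word of ANY length is the dangerous set of a near self-avoiding
  word of some length `m < τ`** (its own last `m` letters, `m` = its maximal age; `τ ≥ 1`);
* `census_subset_image_danger` — conversely each near word of length `m` is a memory-`τ` word, so its state is reached (after `m` letters);
* `disjoint_census` — the pieces for different `m` are disjoint (a piece-`m` state has maximal age exactly `m`);
* `card_census` — **`#⋃_{m<τ} {states of near m-words} = Σ_{m<τ} #{ω ∈ SAW_m : ‖ω(m)‖₁ ≤ τ − m}`**.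

Together: the set of states of the memory-`τ` automaton reachable from `∅` (over all word lengths) is exactly the census union, and its
cardinality is `Σ_{m=0}^{τ−1} Σ_{‖x‖₁ ≤ τ−m} c_m(x)` — the lane's class count `N_d(τ)` is this number of `B_d`-ORBITS (the symmetry
quotient is the engines' business; Burnside weights `(A₂+4[m≤τ/2])/8` on `ℤ²`, `(A₃+3A₂+15A₁+29A₀)/48` on `ℤ³` reproduce every histogram bin of
the lane's runs at `d = 2, τ = 20, 22` and `d = 3, τ = 12, 14` to the unit, gen13/c3check).  All PROVED; nothing here is used by a certified
`p_c` cell.  Written by prim-pcint-2 gen 13 (prover-prim-pcint-2-g13-0), 2026-08-23.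
-/

noncomputable section

open Literature.Probability.LatticeModels Literature.Probability.Percolation
open Summit.CriticalPhenomena.PercolationContinuityZ3.Theorems.Pcint
  (IsMem MState l1 danger mem_danger danger_zero)

namespace Summit.CriticalPhenomena.PercolationContinuityZ3.Theorems.Pcint.MemoryTail

variable {d : ℕ}

/-! ### Re-indexing and the suffix of maximal age -/

/-- Re-indexing a word along `Fin n' = Fin n` does not change its dangerous set. [folklore] -/
theorem danger_comp_cast {τ n n' : ℕ} (h : n' = n) (w : Fin n → Fin d × Bool) :
    danger τ (fun i : Fin n' => w (Fin.cast h i)) = danger τ w := by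
  subst h; rfl

/-- Re-indexing a word along `Fin n' = Fin n` preserves memory `τ`. [folklore] -/
theorem isMem_comp_cast {τ n n' : ℕ} (h : n' = n) {w : Fin n → Fin d × Bool} (hw : IsMem τ w) :
    IsMem τ (fun i : Fin n' => w (Fin.cast h i)) := by
  subst h; exact hw

/-- If no site of age `> m` is dangerous, the dangerous set of a word of length `N + m` is the dangerous set of its last `m` letters.
[folklore] -/
theorem danger_eq_danger_suffix_of_age_le (τ N m : ℕ) (w : Fin (N + m) → Fin d × Bool)
    (h : ∀ q ∈ danger τ w, q.2 ≤ m) : danger τ w = danger τ (fun i : Fin m => w (Fin.natAdd N i)) := by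
  ext ⟨r, j⟩
  constructor
  · intro hq
    have hjm : j ≤ m := h _ hq
    rw [mem_danger] at hq ⊢
    obtain ⟨h1, h2, h3, hr, hl⟩ := hq
    refine ⟨h1, h2, hjm, ?_, hl⟩
    rw [hr, wordPos_suffix w (m - j) (by omega), wordPos_suffix w m le_rfl,
      show N + (m - j) = N + m - j by omega]
    abel
  · intro hq
    rw [mem_danger] at hq ⊢
    obtain ⟨h1, h2, h3, hr, hl⟩ := hq
    refine ⟨h1, h2, by omega, ?_, hl⟩
    rw [hr, wordPos_suffix w (m - j) (by omega), wordPos_suffix w m le_rfl,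
      show N + (m - j) = N + m - j by omega]
    abel

/-! ### Every reachable state is a census state -/

open Classical in
/-- **Every state is a census state** (`τ ≥ 1`): the dangerous set of a memory-`τ` word of any length `n` is the dangerous set of a
near self-avoiding word of some length `m < τ` — namely of its own last `m` letters, `m` its maximal dangerous age (`m = 0`: the
empty word). [folklore] -/
theorem image_danger_subset_census (d τ n : ℕ) (hτ : 1 ≤ τ) :
    (memWords d τ n).image (danger τ) ⊆
      (Finset.range τ).biUnion fun m =>
        ((sawWords d m).filter fun w => l1 (wordPos w m) ≤ τ - m).image (danger τ) := by
  intro S hS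
  rw [Finset.mem_image] at hS
  obtain ⟨w, hw, rfl⟩ := hS
  rw [mem_memWords] at hw
  rw [Finset.mem_biUnion]
  by_cases he : danger τ w = ∅
  · refine ⟨0, Finset.mem_range.2 (by omega), ?_⟩
    rw [he, Finset.mem_image]
    refine ⟨fun i : Fin 0 => i.elim0, ?_, danger_zero τ _⟩
    rw [Finset.mem_filter, mem_sawWords]
    exact ⟨fun i j hi hj _ => by omega, by simp [l1]⟩
  · have hne : (danger τ w).Nonempty := Finset.nonempty_iff_ne_empty.2 he
    have hne' : ((danger τ w).image Prod.snd).Nonempty := hne.image _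
    set m := ((danger τ w).image Prod.snd).max' hne' with hm_def
    have hmax : ∀ q ∈ danger τ w, q.2 ≤ m := fun q hq =>
      Finset.le_max' _ _ (Finset.mem_image_of_mem Prod.snd hq)
    obtain ⟨q0, hq0, hq0m⟩ : ∃ q ∈ danger τ w, q.2 = m := by
      have := Finset.max'_mem ((danger τ w).image Prod.snd) hne'
      rw [Finset.mem_image] at this
      obtain ⟨q, hq, hqm⟩ := this
      exact ⟨q, hq, hqm⟩
    have hfacts : 1 ≤ m ∧ m ≤ τ - 1 ∧ m ≤ n := by
      have h' := (mem_danger w q0).1 hq0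
      rw [hq0m] at h'
      exact ⟨h'.1, h'.2.1, h'.2.2.1⟩
    obtain ⟨h1, h2, h3⟩ := hfacts
    -- re-index `w` along `Fin ((n - m) + m) = Fin n` and take the last `m` letters
    have hNm : (n - m) + m = n := by omega
    set w' : Fin ((n - m) + m) → Fin d × Bool := fun i => w (Fin.cast hNm i) with hw'_def
    have hdw : danger τ w' = danger τ w := danger_comp_cast hNm w
    have hmax' : ∀ q ∈ danger τ w', q.2 ≤ m := by rw [hdw]; exact hmax
    have hsuf := danger_eq_danger_suffix_of_age_le τ (n - m) m w' hmax'
    refine ⟨m, Finset.mem_range.2 (by omega), ?_⟩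
    rw [Finset.mem_image]
    refine ⟨fun i : Fin m => w' (Fin.natAdd (n - m) i), ?_, by rw [← hsuf, hdw]⟩
    rw [Finset.mem_filter, mem_sawWords]
    have hmem' : IsMem τ (fun i : Fin m => w' (Fin.natAdd (n - m) i)) := isMem_suffix (isMem_comp_cast hNm hw)
    refine ⟨isSAW_of_isMem (by omega : m ≤ τ) hmem', ?_⟩
    have hq : (q0.1, m) ∈ danger τ (fun i : Fin m => w' (Fin.natAdd (n - m) i)) := by
      rw [← hsuf, hdw, ← hq0m]
      exact hq0
    exact near_of_mem_danger hq

/-- Conversely each census piece consists of reached states: a near self-avoiding word of length `m ≤ τ` is a memory-`τ` word.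
[folklore] -/
theorem census_subset_image_danger (d τ m : ℕ) (hm : m ≤ τ) :
    ((sawWords d m).filter fun w => l1 (wordPos w m) ≤ τ - m).image (danger τ) ⊆ (memWords d τ m).image (danger τ) := by
  classical
  refine Finset.image_subset_image ?_
  intro w hw
  rw [Finset.mem_filter] at hw
  rw [memWords_eq_sawWords hm]
  exact hw.1

/-! ### The pieces are disjoint; the census count -/

/-- A piece-`m` state (`m ≤ τ − 1`) has all ages `≤ m` and, if `m ≥ 1`, contains a site of age `m`. [folklore] -/
theorem ages_of_mem_census_piece {τ m : ℕ} (hmτ : m ≤ τ - 1) {S : MState d}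
    (hS : S ∈ ((sawWords d m).filter fun w => l1 (wordPos w m) ≤ τ - m).image (danger τ)) :
    (∀ q ∈ S, q.2 ≤ m) ∧ (1 ≤ m → ∃ r : Site d, (r, m) ∈ S) := by
  classical
  rw [Finset.mem_image] at hS
  obtain ⟨w, hw, rfl⟩ := hS
  rw [Finset.mem_filter] at hw
  refine ⟨fun q hq => ?_, fun hm1 => ⟨_, mem_danger_of_near (by omega) hw.2 hm1 le_rfl hmτ⟩⟩
  rw [mem_danger] at hq
  exact hq.2.2.1

/-- **The census pieces are pairwise disjoint** (maximal age distinguishes them). [folklore] -/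
theorem disjoint_census (d τ : ℕ) {m₁ m₂ : ℕ} (h₁ : m₁ ≤ τ - 1) (h₂ : m₂ ≤ τ - 1) (hne : m₁ ≠ m₂) :
    Disjoint (((sawWords d m₁).filter fun w => l1 (wordPos w m₁) ≤ τ - m₁).image (danger τ))
      (((sawWords d m₂).filter fun w => l1 (wordPos w m₂) ≤ τ - m₂).image (danger τ)) := by
  classical
  rw [Finset.disjoint_left]
  intro S hS1 hS2
  obtain ⟨hle1, hex1⟩ := ages_of_mem_census_piece h₁ hS1
  obtain ⟨hle2, hex2⟩ := ages_of_mem_census_piece h₂ hS2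
  rcases Nat.lt_or_gt_of_ne hne with hlt | hlt
  · obtain ⟨r, hr⟩ := hex2 (by omega)
    have := hle1 _ hr
    simp only at this
    omega
  · obtain ⟨r, hr⟩ := hex1 (by omega)
    have := hle2 _ hr
    simp only at this
    omega

open Classical in
/-- **The census count**: the union over lengths `m < τ` of the states of near self-avoiding `m`-words has exactly
`Σ_{m<τ} #{ω ∈ SAW_m : ‖ω(m)‖₁ ≤ τ − m}` elements (disjoint pieces, each in bijection with its words by `danger_injOn_near`).
With `image_danger_subset_census` / `census_subset_image_danger` this union IS the reachable state set of the memory-`τ`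
automaton, so `#states = Σ_{m=0}^{τ−1} Σ_{‖x‖₁ ≤ τ−m} c_m(x)`. [folklore] -/
theorem card_census (d τ : ℕ) :
    ((Finset.range τ).biUnion fun m =>
        ((sawWords d m).filter fun w => l1 (wordPos w m) ≤ τ - m).image (danger τ)).card =
      ∑ m ∈ Finset.range τ, ((sawWords d m).filter fun w => l1 (wordPos w m) ≤ τ - m).card := by
  rw [Finset.card_biUnion]
  · refine Finset.sum_congr rfl fun m hm => ?_
    rw [Finset.mem_range] at hm
    refine Finset.card_image_of_injOn ((danger_injOn_near τ m (by omega)).mono fun w hw => ?_)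
    rw [Finset.mem_coe, Finset.mem_filter] at hw
    exact hw.2
  · intro m₁ hm₁ m₂ hm₂ hne
    rw [Finset.mem_coe, Finset.mem_range] at hm₁ hm₂
    exact disjoint_census d τ (by omega) (by omega) hne

end Summit.CriticalPhenomena.PercolationContinuityZ3.Theorems.Pcint.MemoryTail
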